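import Summits.KontsevichZagierPeriods.KontsevichZagierPeriods.Theorems.LinRedNormalFormArrangementNormalFormStubRebaseSimplePosOneFibreApex

/-!
# Stub `stub_rebaseSimplePosOne`, residual hypothesis `Hpar` (crux `ArrangementNormalForm`,
line `janus-bands`, v6.2) — sub-part `ParUnfold`

**UNFOLDING**: the Newton–Leibniz move (rule 3 of the Kontsevich–Zagier calculus) read
BACKWARDS, packaged. Given a representation `r'` on a `ℚ`-semialgebraic base `τ ⊆ ℝᴺ` whose
integrand is `F (x, b x) − F (x, a x)` for a fibrewise primitive `F` of a function `f` on the band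
`{(x, t) | x ∈ τ, a x < t < b x}` (`a < b` semialgebraic on `τ`), the band carries a representation
`r` with integrand `f` and `[r] − [r'] ∈ KZ.relations` — PROVIDED `f` is absolutely integrable on
the band. This absolute convergence is the whole point of an unfolding (it fails for the naive
unfolding of `1/((y−ℓ)(y−τ))` across a point between `ℓ` and `τ`); here it is obtained by TONELLI
from a fibrewise primitive `Ψ` of `|f|` whose increment `Ψ (x, b x) − Ψ (x, a x)` is absolutely
integrable on `τ` (`RebasePos.integrableOn_band_of_primitive_abs`, `RebasePos.unfold_pack`).
This is the dimension-raising step of the UNFOLD–EXCHANGE treatment of THIN parallel bands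
(`1/((y − ℓ₂)(y − τ)) = (1/(τ − ℓ₂)) ∫_{ℓ₂}^{τ} dσ/(y − σ)²` when `y` is never between `ℓ₂` and
`τ`), see sub-part `ParExchange`.

References: M. Kontsevich, D. Zagier, *Periods* (2001), §1.2, rule (3).
-/

noncomputable section

open Set MeasureTheory MvPolynomial
open Literature.NumberTheory.Transcendental Literature.ModelTheory.ExponentialFields

namespace Summit.KontsevichZagierPeriods.ArrangementNormalForm.JanusBands

namespace RebasePos

open SeparatePos IntegrateOut

section Unfold

variable {N : ℕ}

/-- The open band over `τ` between `a` and `b` (last coordinate) is the closed band minus the two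
graphs. -/
theorem openBand_eq (τ : Set (Fin N → ℝ)) (a b : (Fin N → ℝ) → ℝ) :
    {z : Fin (N + 1) → ℝ | (Fin.init z : Fin N → ℝ) ∈ τ ∧ a (Fin.init z) < z (Fin.last N) ∧ z (Fin.last N) < b (Fin.init z)} =
      KZlog.band τ a b \
      ({z | (Fin.init z : Fin N → ℝ) ∈ τ ∧ z (Fin.last N) = a (Fin.init z)} ∪
        {z | (Fin.init z : Fin N → ℝ) ∈ τ ∧ z (Fin.last N) = b (Fin.init z)}) := by
  ext z
  simp only [KZlog.mem_band, mem_sdiff, mem_union, mem_setOf_eq, not_or, not_and]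
  constructor
  · rintro ⟨hτ, h1, h2⟩
    exact ⟨⟨hτ, h1.le, h2.le⟩, fun _ => h1.ne', fun _ => h2.ne⟩
  · rintro ⟨⟨hτ, h1, h2⟩, ha, hb⟩
    exact ⟨hτ, lt_of_le_of_ne h1 (Ne.symm (ha hτ)), lt_of_le_of_ne h2 (hb hτ)⟩

/-- The open band is contained in the closed band. -/
theorem openBand_subset_band (τ : Set (Fin N → ℝ)) (a b : (Fin N → ℝ) → ℝ) :
    {z : Fin (N + 1) → ℝ | (Fin.init z : Fin N → ℝ) ∈ τ ∧ a (Fin.init z) < z (Fin.last N) ∧ z (Fin.last N) < b (Fin.init z)} ⊆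
      KZlog.band τ a b := fun _ hz => ⟨hz.1, hz.2.1.le, hz.2.2.le⟩

/-- The open band over a semialgebraic base between semialgebraic functions is semialgebraic. -/
theorem isSemialgebraic_openBand' {τ : Set (Fin N → ℝ)} {a b : (Fin N → ℝ) → ℝ}
    (ha : IsSemialgebraicFunOn ℚ τ a) (hb : IsSemialgebraicFunOn ℚ τ b) :
    IsSemialgebraic ℚ {z : Fin (N + 1) → ℝ | (Fin.init z : Fin N → ℝ) ∈ τ ∧ a (Fin.init z) < z (Fin.last N) ∧ z (Fin.last N) < b (Fin.init z)} := by
  rw [openBand_eq]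
  exact (KZlog.isSemialgebraic_band ha hb).diff
    ((isSemialgebraicFunOn_iff.mp ha).union (isSemialgebraicFunOn_iff.mp hb))

/-- The fibre of the band indicator over a base point of `τ`. -/
theorem indicator_band_snoc_of_mem {τ : Set (Fin N → ℝ)} {a b : (Fin N → ℝ) → ℝ}
    (g : (Fin (N + 1) → ℝ) → ENNReal) {x : Fin N → ℝ} (hx : x ∈ τ) :
    (fun t : ℝ => (KZlog.band τ a b).indicator g (Fin.snoc x t)) =
      (Icc (a x) (b x)).indicator fun t => g (Fin.snoc x t) := by
  funext t
  by_cases ht : t ∈ Icc (a x) (b x)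
  · rw [indicator_of_mem ht, indicator_of_mem (KZlog.snoc_mem_band.2 ⟨hx, ht⟩)]
  · rw [indicator_of_notMem ht, indicator_of_notMem (fun h => ht (KZlog.snoc_mem_band.1 h).2)]

/-- The fibre of the band indicator over a base point outside `τ`. -/
theorem indicator_band_snoc_of_not_mem {τ : Set (Fin N → ℝ)} {a b : (Fin N → ℝ) → ℝ}
    (g : (Fin (N + 1) → ℝ) → ENNReal) {x : Fin N → ℝ} (hx : x ∉ τ) :
    (fun t : ℝ => (KZlog.band τ a b).indicator g (Fin.snoc x t)) = 0 := by
  funext t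
  rw [Pi.zero_apply, indicator_of_notMem (fun h => hx (KZlog.snoc_mem_band.1 h).1)]

/-- **Absolute convergence on a band from a fibrewise primitive of `|f|` (Tonelli).** If on each
fibre `[a x, b x]` (`x ∈ τ`) the function `Ψ (x, ·)` is continuous with derivative `|f (x, ·)|` on
the open fibre, and the increment `Ψ (x, b x) − Ψ (x, a x)` is absolutely integrable on `τ`, then
`f` is absolutely integrable on the band. -/
theorem integrableOn_band_of_primitive_abs {τ : Set (Fin N → ℝ)} (hτ : IsSemialgebraic ℚ τ)
    {a b : (Fin N → ℝ) → ℝ} (ha : IsSemialgebraicFunOn ℚ τ a) (hb : IsSemialgebraicFunOn ℚ τ b)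
    (hab : ∀ x ∈ τ, a x < b x) {f Ψ : (Fin (N + 1) → ℝ) → ℝ}
    (hf : IsSemialgebraicFunOn ℚ (KZlog.band τ a b) f)
    (hΨcont : ∀ x ∈ τ, ContinuousOn (fun t => Ψ (Fin.snoc x t)) (Icc (a x) (b x)))
    (hΨder : ∀ x ∈ τ, ∀ t ∈ Ioo (a x) (b x),
      HasDerivAt (fun s => Ψ (Fin.snoc x s)) (|f (Fin.snoc x t)|) t)
    (hΨint : IntegrableOn (fun x => Ψ (Fin.snoc x (b x)) - Ψ (Fin.snoc x (a x))) τ) :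
    IntegrableOn f (KZlog.band τ a b) := by
  set Bd := KZlog.band τ a b with hBd
  have hτm : MeasurableSet τ := IsSemialgebraic.measurableSet_holds hτ
  have hBm : MeasurableSet Bd := IsSemialgebraic.measurableSet_holds (KZlog.isSemialgebraic_band ha hb)
  have hfm : AEStronglyMeasurable f (volume.restrict Bd) :=
    KZ.aestronglyMeasurable_of_isSemialgebraicFunOn hf hBm
  refine ⟨hfm, ?_⟩
  -- Tonelli along the last coordinate
  set Φ : (Fin (N + 1) → ℝ) → ENNReal := Bd.indicator fun z => ‖f z‖ₑ with hΦ
  have hΦm : AEMeasurable Φ volume := (aemeasurable_indicator_iff hBm).mpr hfm.enorm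
  have hlin : ∫⁻ z in Bd, ‖f z‖ₑ = ∫⁻ z, Φ z := by rw [hΦ, lintegral_indicator hBm]
  rw [HasFiniteIntegral, hlin, (lintegral_eq_lintegral_lintegral_snoc hΦm).1]
  -- the fibre integrals
  have hfib : ∀ x : Fin N → ℝ, ∫⁻ t, Φ (Fin.snoc x t) =
      τ.indicator (fun x => ENNReal.ofReal (Ψ (Fin.snoc x (b x)) - Ψ (Fin.snoc x (a x)))) x := by
    intro x
    by_cases hx : x ∈ τ
    · rw [hΦ, indicator_band_snoc_of_mem _ hx, indicator_of_mem hx, lintegral_indicator measurableSet_Icc]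
      -- the fundamental theorem of calculus for the non-negative function `|f (x, ·)|`
      have hI : IntegrableOn (fun t => |f (Fin.snoc x t)|) (Ioc (a x) (b x)) :=
        intervalIntegral.integrableOn_deriv_of_nonneg (hΨcont x hx) (hΨder x hx)
          fun t _ => abs_nonneg _
      have hFTC : ∫ t in Ioc (a x) (b x), |f (Fin.snoc x t)| =
          Ψ (Fin.snoc x (b x)) - Ψ (Fin.snoc x (a x)) := by
        rw [← intervalIntegral.integral_of_le (hab x hx).le]
        exact intervalIntegral.integral_eq_sub_of_hasDerivAt_of_le (hab x hx).le (hΨcont x hx)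
          (hΨder x hx) ((intervalIntegrable_iff_integrableOn_Ioc_of_le (hab x hx).le).2 hI)
      have h1 : ∫⁻ t in Icc (a x) (b x), ‖f (Fin.snoc x t)‖ₑ =
          ∫⁻ t in Ioc (a x) (b x), ENNReal.ofReal |f (Fin.snoc x t)| := by
        rw [← restrict_Ioc_eq_restrict_Icc]
        simp_rw [Real.enorm_eq_ofReal_abs]
      rw [h1, ← ofReal_integral_eq_lintegral_ofReal hI (ae_of_all _ fun t => abs_nonneg _), hFTC]
    · rw [hΦ, indicator_band_snoc_of_not_mem _ hx, indicator_of_notMem hx]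
      exact lintegral_zero_fun
  simp_rw [hfib]
  rw [lintegral_indicator hτm]
  refine lt_of_le_of_lt (lintegral_mono fun x => Real.ofReal_le_enorm _) ?_
  exact hΨint.2

/-- **Unfolding (rule 3 read backwards), packaged.** Let `τ ⊆ ℝᴺ` be `ℚ`-semialgebraic,
`a < b` `ℚ`-semialgebraic on `τ`, `f`, `F` `ℚ`-semialgebraic on the closed band with
`t ↦ F (x, t)` continuous on `[a x, b x]` and `∂ₜ F (x, t) = f (x, t)` on `(a x, b x)` (`x ∈ τ`),
and let `Ψ` be a fibrewise primitive of `|f|` in the same sense whose increment is absolutely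
integrable on `τ`. If `r'` is a representation on `τ` with integrand `F (x, b x) − F (x, a x)`,
then the open band carries a representation `r` with integrand `f` and
`[r] − [r'] ∈ KZ.relations`. -/
theorem unfold_pack {τ : Set (Fin N → ℝ)} (hτ : IsSemialgebraic ℚ τ)
    {a b : (Fin N → ℝ) → ℝ} (ha : IsSemialgebraicFunOn ℚ τ a) (hb : IsSemialgebraicFunOn ℚ τ b)
    (hab : ∀ x ∈ τ, a x < b x) {f F Ψ : (Fin (N + 1) → ℝ) → ℝ}
    (hf : IsSemialgebraicFunOn ℚ (KZlog.band τ a b) f)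
    (hF : IsSemialgebraicFunOn ℚ (KZlog.band τ a b) F)
    (hcont : ∀ x ∈ τ, ContinuousOn (fun t => F (Fin.snoc x t)) (Icc (a x) (b x)))
    (hder : ∀ x ∈ τ, ∀ t ∈ Ioo (a x) (b x),
      HasDerivAt (fun s => F (Fin.snoc x s)) (f (Fin.snoc x t)) t)
    (hΨcont : ∀ x ∈ τ, ContinuousOn (fun t => Ψ (Fin.snoc x t)) (Icc (a x) (b x)))
    (hΨder : ∀ x ∈ τ, ∀ t ∈ Ioo (a x) (b x),
      HasDerivAt (fun s => Ψ (Fin.snoc x s)) (|f (Fin.snoc x t)|) t)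
    (hΨint : IntegrableOn (fun x => Ψ (Fin.snoc x (b x)) - Ψ (Fin.snoc x (a x))) τ)
    (r' : KZ.IntegralRep N) (hr'd : r'.domain = τ)
    (hr'i : EqOn r'.integrand (fun x => F (Fin.snoc x (b x)) - F (Fin.snoc x (a x))) τ) :
    ∃ r : KZ.IntegralRep (N + 1),
      r.domain = {z : Fin (N + 1) → ℝ | (Fin.init z : Fin N → ℝ) ∈ τ ∧ a (Fin.init z) < z (Fin.last N) ∧ z (Fin.last N) < b (Fin.init z)} ∧
      r.integrand = f ∧ KZ.of r - KZ.of r' ∈ KZ.relations := by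
  have hfB : IntegrableOn f (KZlog.band τ a b) :=
    integrableOn_band_of_primitive_abs hτ ha hb hab hf hΨcont hΨder hΨint
  have hOsa := isSemialgebraic_openBand' ha hb
  set r : KZ.IntegralRep (N + 1) := ⟨_, f, hOsa,
    hf.mono (openBand_subset_band τ a b) hOsa, hfB.mono_set (openBand_subset_band τ a b)⟩ with hr
  obtain ⟨r'', hd'', hi'', hrel⟩ := newtonLeibniz_pack hτ ha hb hab hf hF hcont hder r rfl
    (fun _ _ => rfl)
  refine ⟨r, rfl, rfl, ?_⟩
  have h2 : KZ.of r'' - KZ.of r' ∈ KZ.relations := by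
    refine KZ.of_sub_of_mem_relations_of_null r'' r' ?_ ?_ fun x hx => ?_
    · rw [hd'', hr'd, sdiff_self, measure_empty]
    · rw [hd'', hr'd, sdiff_self, measure_empty]
    · rw [hi'']
      rw [hd''] at hx
      exact (hr'i hx.1).symm
  have : KZ.of r - KZ.of r' = (KZ.of r - KZ.of r'') + (KZ.of r'' - KZ.of r') := by abel
  rw [this]
  exact KZ.relations.add_mem hrel h2

end Unfold

end RebasePos

/-- **Registered support goal of this file: unfolding, packaged** (`RebasePos.unfold_pack`): the
Newton–Leibniz move read backwards, the absolute convergence of the unfolded band being supplied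
by Tonelli from a fibrewise primitive `Ψ` of `|f|` with absolutely integrable increment. -/
theorem rebaseSimplePos_unfoldPack (N : ℕ) (τ : Set (Fin N → ℝ)) (hτ : IsSemialgebraic ℚ τ) (a b : (Fin N → ℝ) → ℝ) (ha : IsSemialgebraicFunOn ℚ τ a) (hb : IsSemialgebraicFunOn ℚ τ b) (hab : ∀ x ∈ τ, a x < b x) (f F Ψ : (Fin (N + 1) → ℝ) → ℝ) (hf : IsSemialgebraicFunOn ℚ (KZlog.band τ a b) f) (hF : IsSemialgebraicFunOn ℚ (KZlog.band τ a b) F) (hcont : ∀ x ∈ τ, ContinuousOn (fun t => F (Fin.snoc x t)) (Set.Icc (a x) (b x))) (hder : ∀ x ∈ τ, ∀ t ∈ Set.Ioo (a x) (b x), HasDerivAt (fun s => F (Fin.snoc x s)) (f (Fin.snoc x t)) t) (hΨcont : ∀ x ∈ τ, ContinuousOn (fun t => Ψ (Fin.snoc x t)) (Set.Icc (a x) (b x))) (hΨder : ∀ x ∈ τ, ∀ t ∈ Set.Ioo (a x) (b x), HasDerivAt (fun s => Ψ (Fin.snoc x s)) (|f (Fin.snoc x t)|) t) (hΨint : IntegrableOn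 (fun x => Ψ (Fin.snoc x (b x)) - Ψ (Fin.snoc x (a x))) τ) (r' : KZ.IntegralRep N) (hr'd : r'.domain = τ) (hr'i : Set.EqOn r'.integrand (fun x => F (Fin.snoc x (b x)) - F (Fin.snoc x (a x))) τ) : ∃ r : KZ.IntegralRep (N + 1), r.domain = {z | (Fin.init z : Fin N → ℝ) ∈ τ ∧ a (Fin.init z) < z (Fin.last N) ∧ z (Fin.last N) < b (Fin.init z)} ∧ r.integrand = f ∧ KZ.of r - KZ.of r' ∈ KZ.relations :=
  RebasePos.unfold_pack hτ ha hb hab hf hF hcont hder hΨcont hΨder hΨint r' hr'd hr'i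

end Summit.KontsevichZagierPeriods.ArrangementNormalForm.JanusBands
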